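/-
Copyright: the b2b-balaban T⁴-continuum CRUX team, row NE7b leaf lineage `t4-ne7b-formalise-leaf-05` (gen 154). Project licence.
-/
import Mathlib.Algebra.Group.Equiv.TypeTags
import Literature.MathematicalPhysics.QuantumFieldTheory.Balaban1983to89.UnitaryModel
import Literature.MathematicalPhysics.QuantumFieldTheory.Balaban1983to89.T4AdjointCovarianceUnitary

/-!
# THE SIZE LETTERS OF THE LINEARISED STOKES PACKET ON THE CELL'S `U(N)`: `φ = Ad` on `𝔲(N)` as a hom into `MulAut (Multiplicative 𝔲(N))`,
# `sz` = the OPERATOR norm (B7 (19)), `dist1` = the cell's `U(N)` instance (`‖g − 1‖_op`), conjugation-defect constant `c = 2`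
# (row NE7b, node U5c; companion of `Spine/NE7b/LinearisedLatticeStokes` ∕ `…Rectangle` ∕ `CovariantStokesCounting` — Lemma CS of
# `HOME/b2b-balaban-r1/SectE-interface-proof.md`; this file discharges their DISPLAYED size letters on the cell's own gauge group)

Cell `pub-balaban`, sub-cell `t4`, spine estimate NE7b (`T4WeightBudget.RelWeightBound`; the cell's OWN estimate — NOT PRINTED in [Bałaban 1983–89],
NOT PROVED).  Crux-route work under `Spine/NE7b/` by a row leaf; [folklore] matrix algebra; NOTHING of Bałaban's estimates is named, asserted or
valued; no `T4Continuum/Support` leaf typed; no `def`; zero `sorry`.  Imports: Mathlib + two BUILT Literature modules used BY NAME —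
`….Balaban1983to89.UnitaryModel` (the cell's `GaugeGroup` instance on `Matrix.unitaryGroup n ℂ`: `dist1 g = ‖g − 1‖` in the L²-operator norm,
`instGaugeGroupUnitaryGroup` ∕ `GaugeGroup.ofUnitaryRep_dist1`) and `….T4AdjointCovarianceUnitary` (`lieU n = 𝔲(n)`, `unitaryAd g : 𝔲(n) ≃ₗᵢ[ℝ] 𝔲(n)`,
`X ↦ gXg*`, with `unitaryAd_mul ∕ unitaryAd_one ∕ coe_unitaryAd`, and the operator norm `opNormU` with `opNormU_unitaryAd`).  The packet's parts
I–II are NOT imported (no hub olean is needed): their size letters are HYPOTHESIS SHAPES, and this file proves exactly those shapes.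

WHAT IS PROVED ([folklore]):
* §1 **`exists_mulAut_unitaryAd`** — `Ad` AS THE HOM THE PACKET WANTS: `∃ φ : U(n) →* MulAut (Multiplicative 𝔲(n)), ∀ g a, toAdd (φ g a) = Ad(g)(toAdd a)`
  (`AddEquiv.toMultiplicative` of the linear isometry `unitaryAd g`; `unitaryAd_mul` gives the hom law); `dist1_unitaryGroup_eq` (`dist1 g = ‖(g : M_n(ℂ)) − 1‖`).
* §2 **`norm_conj_sub_self_le_unitary`** — THE DEFECT IN THE OPERATOR NORM: `‖gXg* − X‖ ≤ 2·‖g − 1‖·‖X‖` for `g ∈ U(n)` and ANY matrix `X`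
  (`gXg* − X = (g − 1)Xg* + X(g* − 1)`, `‖g*‖ = 1`, `‖g* − 1‖ = ‖g − 1‖` by `UnitaryModel.opDist1_conjTranspose`).
* §3 **`sz_letters_unitaryAd`** — THE FIVE LETTERS of `LinearisedLatticeStokes.sz_ladder_defect_le` ∕ `…Rectangle.sz_rectWord_defect_le` for ANY `φ` reading
  `Ad` (`hφ : toAdd (φ g a) = unitaryAd g (toAdd a)`), with `sz a := opNormU (toAdd a)` and **`c = 2`** against the instance's `dist1`: nonnegativity,
  subadditivity, inversion invariance, `φ`-isometry (`opNormU_unitaryAd`), conjugation defect (§2).  So on the cell's `U(N)` with 𝔲(N)-valued bond forms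
  in the operator norm, the packet's ENDs hold with nothing displayed but the lattice instance ((R-M), (R-V), `c_g ε_F`, the sets ∕ counts).

* §4 the `SU(n)` twin: `dist1_specialUnitaryGroup_eq`, **`sz_letters_specialUnitaryAd`**, `exists_mulAut_specialUnitaryAd` (through `toUnitary`).

NOT HERE (honest): the Hilbert–Schmidt norm variant (the isometry is `norm_unitaryAd`; its defect constant carries `√n` against the operator `dist1`
and is not needed by (5.2), which reads `|·|` as the operator norm, B7 (19)); anything of Bałaban's.  BY-NAME EFFECT ON THE WALL: NONE.  NE7b NOT PRINTED ∕ NOT PROVED; spine PROVED 0∕9; rung (B)+1 on a FINITE torus —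
NOT infinite volume, NOT the mass gap, NOT Clay.
HONEST DEPENDENCY: continuum YM on T⁴ ⇐ BetaPertH ∧ nine spine estimates (0/9 proved); BetaPertH ⇐ (D1) ∧ (D4) ∧ CAP+tail; G-an2-4 gates asym, D1
and NE2/3/4.
-/

set_option autoImplicit false

namespace Summit.QuantumFields.BalabanUV.T4Continuum.NE7b.LinearisedLatticeStokesUnitary

open Literature.MathematicalPhysics.QuantumFieldTheory.Balaban1983to89 (GaugeGroup dist1)
open Literature.MathematicalPhysics.QuantumFieldTheory.Balaban1983to89.T4AdjointCovarianceUnitary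
  (lieU unitaryAd coe_unitaryAd unitaryAd_mul unitaryAd_one opNormU opNormU_unitaryAd toUnitary coe_toUnitary toUnitary_mul)
open scoped Matrix.Norms.L2Operator

variable {n : Type*} [Fintype n] [DecidableEq n]

/-! ## §1 `Ad` as a hom `U(n) →* MulAut (Multiplicative 𝔲(n))`; the instance's `dist1` -/

/-- **`Ad` AS THE HOM THE PACKET WANTS**: there is `φ : U(n) →* MulAut (Multiplicative 𝔲(n))` with `toAdd (φ g a) = Ad(g)(toAdd a)` — the
`Multiplicative` transcription of the linear isometries `unitaryAd g` (hom law from `unitaryAd_mul`). [folklore] -/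
theorem exists_mulAut_unitaryAd :
    ∃ φ : Matrix.unitaryGroup n ℂ →* MulAut (Multiplicative (lieU n)),
      ∀ (g : Matrix.unitaryGroup n ℂ) (a : Multiplicative (lieU n)), (φ g a).toAdd = unitaryAd g a.toAdd := by
  refine ⟨MonoidHom.mk' (fun g => AddEquiv.toMultiplicative (unitaryAd g).toLinearEquiv.toAddEquiv) ?_, ?_⟩
  · intro g h
    apply MulEquiv.ext
    intro a
    show Multiplicative.ofAdd (unitaryAd (g * h) a.toAdd) =
      Multiplicative.ofAdd (unitaryAd g (Multiplicative.ofAdd (unitaryAd h a.toAdd)).toAdd)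
    rw [toAdd_ofAdd, unitaryAd_mul]
  · intro g a
    rfl

/-- The cell's `U(n)` instance reads `dist1 g = ‖(g : M_n(ℂ)) − 1‖` (L²-operator norm; `GaugeGroup.ofUnitaryRep_dist1`). [folklore] -/
theorem dist1_unitaryGroup_eq [Nonempty n] (g : Matrix.unitaryGroup n ℂ) : dist1 g = ‖(g : Matrix n n ℂ) - 1‖ := rfl

/-! ## §2 The conjugation defect in the operator norm -/

/-- `‖g*‖ ≤ 1` for unitary `g` (`= 1` on a nontrivial algebra; `≤ 1` is all that is used). [folklore] -/
theorem norm_star_coe_unitary_le (g : Matrix.unitaryGroup n ℂ) : ‖star (g : Matrix n n ℂ)‖ ≤ 1 := by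
  rw [norm_star]
  rcases subsingleton_or_nontrivial (Matrix n n ℂ) with h | h
  · rw [Subsingleton.elim (g : Matrix n n ℂ) 0, norm_zero]; exact zero_le_one
  · exact (CStarRing.norm_coe_unitary g).le

/-- **THE CONJUGATION DEFECT, OPERATOR NORM**: `‖gXg* − X‖ ≤ 2·‖g − 1‖·‖X‖` for `g ∈ U(n)`, ANY `X ∈ M_n(ℂ)` —
`gXg* − X = (g − 1)Xg* + X(g* − 1)` with `‖g*‖ ≤ 1` and `‖g* − 1‖ = ‖g − 1‖` (`UnitaryModel.opDist1_conjTranspose`). [folklore] -/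
theorem norm_conj_sub_self_le_unitary (g : Matrix.unitaryGroup n ℂ) (X : Matrix n n ℂ) :
    ‖(g : Matrix n n ℂ) * X * star (g : Matrix n n ℂ) - X‖ ≤ 2 * ‖(g : Matrix n n ℂ) - 1‖ * ‖X‖ := by
  have e1 : (g : Matrix n n ℂ) * X * star (g : Matrix n n ℂ) - X =
      ((g : Matrix n n ℂ) - 1) * X * star (g : Matrix n n ℂ) + X * (star (g : Matrix n n ℂ) - 1) := by noncomm_ring
  have hstar : ‖star (g : Matrix n n ℂ) - 1‖ = ‖(g : Matrix n n ℂ) - 1‖ := by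
    have h := Literature.MathematicalPhysics.QuantumFieldTheory.Balaban1983to89.UnitaryModel.opDist1_conjTranspose
      (g : Matrix n n ℂ)
    simpa only [Literature.MathematicalPhysics.QuantumFieldTheory.Balaban1983to89.UnitaryModel.opDist1,
      Matrix.star_eq_conjTranspose] using h
  rw [e1]
  calc ‖((g : Matrix n n ℂ) - 1) * X * star (g : Matrix n n ℂ) + X * (star (g : Matrix n n ℂ) - 1)‖
      ≤ ‖(g : Matrix n n ℂ) - 1‖ * ‖X‖ * ‖star (g : Matrix n n ℂ)‖ + ‖X‖ * ‖star (g : Matrix n n ℂ) - 1‖ :=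
        (norm_add_le _ _).trans (add_le_add ((norm_mul_le _ _).trans
          (mul_le_mul_of_nonneg_right (norm_mul_le _ _) (norm_nonneg _))) (norm_mul_le _ _))
    _ ≤ ‖(g : Matrix n n ℂ) - 1‖ * ‖X‖ * 1 + ‖X‖ * ‖(g : Matrix n n ℂ) - 1‖ := by
        rw [hstar]
        gcongr
        exact norm_star_coe_unitary_le g
    _ = 2 * ‖(g : Matrix n n ℂ) - 1‖ * ‖X‖ := by ring

/-! ## §3 The five size letters for `sz = opNormU ∘ toAdd`, `c = 2`, on the cell's `U(n)` -/

/-- **THE PACKET'S SIZE LETTERS ON `U(n)`.**  For ANY `φ : U(n) →* MulAut (Multiplicative 𝔲(n))` reading `Ad` (`hφ`; one exists by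
`exists_mulAut_unitaryAd`) and `sz a := opNormU (toAdd a)` (operator norm, B7 (19)): `sz ≥ 0`; `sz (a·b) ≤ sz a + sz b`; `sz a⁻¹ = sz a`;
`sz (φ g a) = sz a`; and the conjugation defect `sz (φ g a · a⁻¹) ≤ 2 · dist1 g · sz a` with the instance's `dist1` — VERBATIM the hypotheses
`h0 ∕ hmul ∕ hinv ∕ hiso ∕ hdef` of `LinearisedLatticeStokes.sz_ladder_defect_le` ∕ `LinearisedLatticeStokesRectangle.sz_rectWord_defect_le` at `c = 2`.
[folklore] -/
theorem sz_letters_unitaryAd [Nonempty n] (φ : Matrix.unitaryGroup n ℂ →* MulAut (Multiplicative (lieU n)))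
    (hφ : ∀ (g : Matrix.unitaryGroup n ℂ) (a : Multiplicative (lieU n)), (φ g a).toAdd = unitaryAd g a.toAdd) :
    (∀ a : Multiplicative (lieU n), 0 ≤ opNormU a.toAdd) ∧
    (∀ a b : Multiplicative (lieU n), opNormU (a * b).toAdd ≤ opNormU a.toAdd + opNormU b.toAdd) ∧
    (∀ a : Multiplicative (lieU n), opNormU a⁻¹.toAdd = opNormU a.toAdd) ∧
    (∀ (g : Matrix.unitaryGroup n ℂ) (a : Multiplicative (lieU n)), opNormU (φ g a).toAdd = opNormU a.toAdd) ∧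
    (∀ (g : Matrix.unitaryGroup n ℂ) (a : Multiplicative (lieU n)),
      opNormU (φ g a * a⁻¹).toAdd ≤ 2 * dist1 g * opNormU a.toAdd) := by
  refine ⟨fun a => norm_nonneg _, fun a b => ?_, fun a => ?_, fun g a => ?_, fun g a => ?_⟩
  · show ‖(((a * b).toAdd : lieU n) : Matrix n n ℂ)‖ ≤ ‖((a.toAdd : lieU n) : Matrix n n ℂ)‖ + ‖((b.toAdd : lieU n) : Matrix n n ℂ)‖
    rw [toAdd_mul, Submodule.coe_add]
    exact norm_add_le _ _
  · show ‖(((a⁻¹).toAdd : lieU n) : Matrix n n ℂ)‖ = ‖((a.toAdd : lieU n) : Matrix n n ℂ)‖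
    rw [toAdd_inv, Submodule.coe_neg, norm_neg]
  · rw [hφ]; exact opNormU_unitaryAd g _
  · show ‖(((φ g a * a⁻¹).toAdd : lieU n) : Matrix n n ℂ)‖ ≤ 2 * dist1 g * ‖((a.toAdd : lieU n) : Matrix n n ℂ)‖
    rw [toAdd_mul, toAdd_inv, hφ, Submodule.coe_add, Submodule.coe_neg, coe_unitaryAd, ← sub_eq_add_neg, dist1_unitaryGroup_eq]
    exact norm_conj_sub_self_le_unitary g _

/-! ## §4 The `SU(n)` twin (`T4AdjointCovarianceUnitary.toUnitary`; the cell's `SU(n)` instance reads `dist1` on the same matrix) -/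

/-- The cell's `SU(n)` instance reads `dist1 g = ‖(g : M_n(ℂ)) − 1‖` as well (`GaugeGroup.ofUnitaryRep` through `fundamentalRep`). [folklore] -/
theorem dist1_specialUnitaryGroup_eq [Nonempty n] (g : Matrix.specialUnitaryGroup n ℂ) :
    dist1 g = ‖(g : Matrix n n ℂ) - 1‖ := rfl

/-- **THE LETTERS ON `SU(n)`**: for ANY `φ : SU(n) →* MulAut (Multiplicative 𝔲(n))` reading `Ad ∘ toUnitary` (one exists: compose the `U(n)` hom of
`exists_mulAut_unitaryAd` with `toUnitary`, multiplicative by `toUnitary_mul`) and `sz = opNormU ∘ toAdd`, the same five letters with `c = 2` against the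
`SU(n)` instance's `dist1`. [folklore] -/
theorem sz_letters_specialUnitaryAd [Nonempty n] (φ : Matrix.specialUnitaryGroup n ℂ →* MulAut (Multiplicative (lieU n)))
    (hφ : ∀ (g : Matrix.specialUnitaryGroup n ℂ) (a : Multiplicative (lieU n)), (φ g a).toAdd = unitaryAd (toUnitary g) a.toAdd) :
    (∀ a : Multiplicative (lieU n), 0 ≤ opNormU a.toAdd) ∧
    (∀ a b : Multiplicative (lieU n), opNormU (a * b).toAdd ≤ opNormU a.toAdd + opNormU b.toAdd) ∧
    (∀ a : Multiplicative (lieU n), opNormU a⁻¹.toAdd = opNormU a.toAdd) ∧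
    (∀ (g : Matrix.specialUnitaryGroup n ℂ) (a : Multiplicative (lieU n)), opNormU (φ g a).toAdd = opNormU a.toAdd) ∧
    (∀ (g : Matrix.specialUnitaryGroup n ℂ) (a : Multiplicative (lieU n)),
      opNormU (φ g a * a⁻¹).toAdd ≤ 2 * dist1 g * opNormU a.toAdd) := by
  refine ⟨fun a => norm_nonneg _, fun a b => ?_, fun a => ?_, fun g a => ?_, fun g a => ?_⟩
  · show ‖(((a * b).toAdd : lieU n) : Matrix n n ℂ)‖ ≤ ‖((a.toAdd : lieU n) : Matrix n n ℂ)‖ + ‖((b.toAdd : lieU n) : Matrix n n ℂ)‖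
    rw [toAdd_mul, Submodule.coe_add]
    exact norm_add_le _ _
  · show ‖(((a⁻¹).toAdd : lieU n) : Matrix n n ℂ)‖ = ‖((a.toAdd : lieU n) : Matrix n n ℂ)‖
    rw [toAdd_inv, Submodule.coe_neg, norm_neg]
  · rw [hφ]; exact opNormU_unitaryAd _ _
  · show ‖(((φ g a * a⁻¹).toAdd : lieU n) : Matrix n n ℂ)‖ ≤ 2 * dist1 g * ‖((a.toAdd : lieU n) : Matrix n n ℂ)‖
    rw [toAdd_mul, toAdd_inv, hφ, Submodule.coe_add, Submodule.coe_neg, coe_unitaryAd, ← sub_eq_add_neg, dist1_specialUnitaryGroup_eq,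
      coe_toUnitary]
    exact norm_conj_sub_self_le_unitary (toUnitary g) _

/-- Existence of such a `φ` on `SU(n)`. [folklore] -/
theorem exists_mulAut_specialUnitaryAd :
    ∃ φ : Matrix.specialUnitaryGroup n ℂ →* MulAut (Multiplicative (lieU n)),
      ∀ (g : Matrix.specialUnitaryGroup n ℂ) (a : Multiplicative (lieU n)), (φ g a).toAdd = unitaryAd (toUnitary g) a.toAdd := by
  obtain ⟨φ, hφ⟩ := exists_mulAut_unitaryAd (n := n)
  exact ⟨φ.comp (MonoidHom.mk' toUnitary toUnitary_mul), fun g a => hφ (toUnitary g) a⟩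

end Summit.QuantumFields.BalabanUV.T4Continuum.NE7b.LinearisedLatticeStokesUnitary
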